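import Mathlib.GroupTheory.Index
import Mathlib.GroupTheory.DoubleCoset
import Mathlib.Algebra.BigOperators.Group.Finset.Basic
import Mathlib.SetTheory.Cardinal.Finite
import Mathlib.Data.Set.Card
import Mathlib.Tactic.Group
import HarnessLib

/-!
# The orbit–stabiliser count for an INFINITE group acting on a finite set: `Σ_orbits [Λ : Stab] = #S`, and the
# «cover-degree count» for double cosets: `Σ_{K'-classes x' ⊂ ΓxK} [Γ ∩ x'Kx'⁻¹ : Γ ∩ x'K'x'⁻¹] = [K : K']`

Topic `GroupTheory`.  KERNEL ONLY: theorems over Mathlib's `MulAction` ∕ `Subgroup.index` ∕ `DoubleCoset` (no definition, no named fact).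

* `sum_index_stabilizer_eq_card` — for a group `Λ` (possibly infinite) acting on a FINITE type `S`,
  `Σ_{ω ∈ Λ\S} [Λ : Stab_Λ(ω.out)] = #S` (orbit–stabiliser `[Λ : Stab(s)] = #(Λ·s)`, Mathlib `MulAction.index_stabilizer`, summed over the orbit
  decomposition `MulAction.selfEquivSigmaOrbits`) — [Shimura IATAF, proof of Prop. 3.1: «`Γ α Γ = ⊔ Γ α_i` (disjoint), `d = [Γ : Γ ∩ α⁻¹Γα]`»] in the
  form used for class sets.
* `relIndex_inf_map_conj_eq_of_rel` — for `K' ≤ K`, the «cover degree» `[Γ ∩ yKy⁻¹ : Γ ∩ yK'y⁻¹]` depends only on the double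
  coset `Γ y K'` (`map_conj_mul_of_mem`: `(yk)K(yk)⁻¹ = yKy⁻¹` for `k ∈ K`).
* `sum_fibre_relIndex_inf_map_conj` — the COVER-DEGREE COUNT: for `K' ≤ K` of finite index and `x ∈ G`,
  `Σ_{Γ x' K' ⊂ Γ x K} [Γ ∩ x'Kx'⁻¹ : Γ ∩ x'K'x'⁻¹] = [K : K']` (sum over the fibre of `Γ\G/K' → Γ\G/K` above `Γ x K`, terms read on
  `x' = q'.out`): the fibre is the orbit space of `Γ ∩ xKx⁻¹` on `K/K'` (via `γ ↦ x⁻¹γx`), the stabiliser of `kK'` is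
  `Γ ∩ (xk)K'(xk)⁻¹`, and §1 applies.
CONSUMER: the hodgecm-mathlib cell's level-form class-sum (b6) for binder `h413` (A-p10's `SPEC-b6-LevelFormAssembly.md`, input (G2) «cover-degree
count» of B-typ03's SURVEY-III4b: `Σ_{[x'] ⊂ [x]_K} [Γ^K_{x'} : Γ^{K'}_{x'}] = [K : K']`).

## References
* [ShimuraIATAF1971] G. Shimura, *Introduction to the Arithmetic Theory of Automorphic Functions* (1971), §3.1, Prop. 3.1 and its proof
  (decomposition of a double coset into single cosets; degrees as indices of `Γ ∩ αΓα⁻¹`).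
* Mathlib: `MulAction.index_stabilizer`, `MulAction.selfEquivSigmaOrbits`, `Nat.card_sigma` (`Mathlib/GroupTheory/Index.lean`,
  `Mathlib/GroupTheory/GroupAction/Defs.lean`, `Mathlib/SetTheory/Cardinal/Finite.lean`).
-/

namespace Literature.GroupTheory

open MulAction

/-! ## §1 The orbit–stabiliser count for a possibly infinite group on a finite set -/

/-- **`Σ_{orbits} [Λ : Stab] = #S`** for a group `Λ` acting on a finite type `S`: the index of the stabiliser of (a representative of) each
orbit, summed over the orbit space `Λ\S`, is the cardinality of `S` — orbit–stabiliser `[Λ : Stab_Λ(s)] = #(Λ·s)` summed over the orbit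
decomposition.  (For FINITE `Λ` this is Mathlib's class equation; here `Λ` is arbitrary, e.g. an arithmetic group acting on a finite coset
space.) [cite: ShimuraIATAF1971, §3.1, proof of Prop. 3.1] -/
theorem sum_index_stabilizer_eq_card (Λ : Type*) {S : Type*} [Group Λ] [MulAction Λ S] [Fintype S]
    [Fintype (orbitRel.Quotient Λ S)] :
    ∑ ω : orbitRel.Quotient Λ S, (stabilizer Λ ω.out).index = Fintype.card S := by
  classical
  have h1 : ∀ ω : orbitRel.Quotient Λ S, (stabilizer Λ ω.out).index = Nat.card (orbit Λ ω.out) := fun ω => by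
    rw [index_stabilizer, Nat.card_coe_set_eq]
  simp_rw [h1]
  rw [← Nat.card_eq_fintype_card, Nat.card_congr (selfEquivSigmaOrbits Λ S), Nat.card_sigma]

/-! ## §2 Stabilisers of cosets under a conjugated subgroup -/

variable {G : Type*} [Group G]

/-- `y K y⁻¹` as a subgroup: `K.map (MulAut.conj y)`; membership unfolds to `y⁻¹ g y ∈ K`. [cite: ShimuraIATAF1971, §3.1] -/
theorem mem_map_conj_iff (K : Subgroup G) (y g : G) : g ∈ K.map (MulAut.conj y).toMonoidHom ↔ y⁻¹ * g * y ∈ K := by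
  constructor
  · rintro ⟨k, hk, rfl⟩
    simpa [MulAut.conj_apply, mul_assoc] using hk
  · intro h
    refine ⟨y⁻¹ * g * y, h, ?_⟩
    simp [MulAut.conj_apply, mul_assoc]

/-- For `k ∈ K`: `(yk) K (yk)⁻¹ = y K y⁻¹`. [cite: ShimuraIATAF1971, §3.1] -/
theorem map_conj_mul_of_mem (K : Subgroup G) (y : G) {k : G} (hk : k ∈ K) :
    K.map (MulAut.conj (y * k)).toMonoidHom = K.map (MulAut.conj y).toMonoidHom := by
  ext g
  rw [mem_map_conj_iff, mem_map_conj_iff, mul_inv_rev, show k⁻¹ * y⁻¹ * g * (y * k) = k⁻¹ * (y⁻¹ * g * y) * k by group]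
  constructor
  · intro h
    have := K.mul_mem (K.mul_mem hk h) (K.inv_mem hk)
    simpa [mul_assoc] using this
  · intro h
    exact K.mul_mem (K.mul_mem (K.inv_mem hk) h) hk

/-- Conjugating the pair `(Γ ∩ yKy⁻¹, Γ ∩ yK'y⁻¹)` by `γ ∈ Γ` (replacing `y` by `γy`) does not change the relative index.
[cite: ShimuraIATAF1971, §3.1] -/
theorem relIndex_inf_map_conj_mul_left (Γ K K' : Subgroup G) (y : G) {γ : G} (hγ : γ ∈ Γ) :
    (Γ ⊓ K'.map (MulAut.conj (γ * y)).toMonoidHom).relIndex (Γ ⊓ K.map (MulAut.conj (γ * y)).toMonoidHom) =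
      (Γ ⊓ K'.map (MulAut.conj y).toMonoidHom).relIndex (Γ ⊓ K.map (MulAut.conj y).toMonoidHom) := by
  -- both pairs differ by the inner automorphism `conj γ`, which preserves `Γ`
  have hconj : ∀ L : Subgroup G, L.map (MulAut.conj (γ * y)).toMonoidHom =
      (L.map (MulAut.conj y).toMonoidHom).map (MulAut.conj γ).toMonoidHom := by
    intro L
    rw [Subgroup.map_map]
    congr 1
    ext g
    simp [MulAut.conj_apply, mul_assoc]
  have hΓ : Γ.map (MulAut.conj γ).toMonoidHom = Γ := by
    ext g
    rw [mem_map_conj_iff]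
    constructor
    · intro h
      have h' := Γ.mul_mem (Γ.mul_mem hγ h) (Γ.inv_mem hγ)
      simpa [mul_assoc] using h'
    · intro h
      exact Γ.mul_mem (Γ.mul_mem (Γ.inv_mem hγ) h) hγ
  have hmap : ∀ L : Subgroup G, Γ ⊓ L.map (MulAut.conj (γ * y)).toMonoidHom =
      (Γ ⊓ L.map (MulAut.conj y).toMonoidHom).map (MulAut.conj γ).toMonoidHom := by
    intro L
    rw [Subgroup.map_inf _ _ _ (MulAut.conj γ).injective, hΓ, hconj]
  rw [hmap K, hmap K', Subgroup.relIndex_map_map_of_injective _ _ (MulAut.conj γ).injective]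

/-- … and multiplying `y` on the right by `k' ∈ K' ≤ K` does not change it either (`(yk')K(yk')⁻¹ = yKy⁻¹`, same for `K'`).
[cite: ShimuraIATAF1971, §3.1] -/
theorem relIndex_inf_map_conj_mul_right (Γ K K' : Subgroup G) (hK' : K' ≤ K) (y : G) {k' : G} (hk' : k' ∈ K') :
    (Γ ⊓ K'.map (MulAut.conj (y * k')).toMonoidHom).relIndex (Γ ⊓ K.map (MulAut.conj (y * k')).toMonoidHom) =
      (Γ ⊓ K'.map (MulAut.conj y).toMonoidHom).relIndex (Γ ⊓ K.map (MulAut.conj y).toMonoidHom) := by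
  rw [map_conj_mul_of_mem K y (hK' hk'), map_conj_mul_of_mem K' y hk']

/-- **The relative index `[Γ ∩ yKy⁻¹ : Γ ∩ yK'y⁻¹]` depends only on the double coset `Γ y K'`** (for `K' ≤ K`).
[cite: ShimuraIATAF1971, §3.1] -/
theorem relIndex_inf_map_conj_eq_of_rel (Γ K K' : Subgroup G) (hK' : K' ≤ K) {y y' : G}
    (h : DoubleCoset.mk Γ K' y = DoubleCoset.mk Γ K' y') :
    (Γ ⊓ K'.map (MulAut.conj y').toMonoidHom).relIndex (Γ ⊓ K.map (MulAut.conj y').toMonoidHom) =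
      (Γ ⊓ K'.map (MulAut.conj y).toMonoidHom).relIndex (Γ ⊓ K.map (MulAut.conj y).toMonoidHom) := by
  obtain ⟨γ, hγ, k', hk', rfl⟩ := (DoubleCoset.eq Γ K' y y').mp h
  rw [relIndex_inf_map_conj_mul_right Γ K K' hK' (γ * y) hk', relIndex_inf_map_conj_mul_left Γ K K' y hγ]

/-! ## §3 The cover-degree count over a double-coset fibre -/

/-- For `K' ≤ K`: the chosen representative of the `(Γ, K')`-class of `y` still lies in the `(Γ, K)`-double coset of `y`.
[cite: ShimuraIATAF1971, §3.1] -/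
theorem mk_out_mk_eq_of_le (Γ K K' : Subgroup G) (hK' : K' ≤ K) (y : G) :
    DoubleCoset.mk Γ K (DoubleCoset.mk Γ K' y : DoubleCoset.Quotient (Γ : Set G) (K' : Set G)).out = DoubleCoset.mk Γ K y := by
  obtain ⟨u, k', hu, hk', he⟩ := DoubleCoset.mk_out_eq_mul Γ K' y
  rw [he, eq_comm, DoubleCoset.eq]
  exact ⟨u, hu, k', hK' hk', rfl⟩

/-- **Cover-degree count** (`K' ≤ K` of finite index, `Γ ≤ G`, `x ∈ G`).  Summing the «cover degrees»
`[Γ ∩ x'Kx'⁻¹ : Γ ∩ x'K'x'⁻¹]` over the `(Γ, K')`-double cosets `Γ x' K' ⊂ Γ x K` — the fibre of `Γ x K` under `Γ\G/K' → Γ\G/K`, each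
term read on the chosen representative `x' = q'.out` (legitimate by `relIndex_inf_map_conj_eq_of_rel`) — gives `[K : K']`:
`Σ_{Γ q'.out K = Γ x K} [Γ ∩ q'.out K q'.out⁻¹ : Γ ∩ q'.out K' q'.out⁻¹] = [K : K']`.
Proof: the fibre is the orbit space of `Λ := Γ ∩ xKx⁻¹` acting on `K/K'` through `γ ↦ x⁻¹γx`, the stabiliser of `kK'` is
`Γ ∩ (xk)K'(xk)⁻¹` while `(xk)K(xk)⁻¹ = xKx⁻¹`, and §1 applies.  (In [Shimura]: `ΓαΓ = ⊔_i Γα_i`, `#i = [Γ : Γ ∩ α⁻¹Γα]`.)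
[cite: ShimuraIATAF1971, §3.1, proof of Prop. 3.1] -/
theorem sum_fibre_relIndex_inf_map_conj (Γ K K' : Subgroup G) (hK' : K' ≤ K) [K'.IsFiniteRelIndex K] (x : G)
    [Fintype (DoubleCoset.Quotient (Γ : Set G) (K' : Set G))] [DecidableEq (DoubleCoset.Quotient (Γ : Set G) (K : Set G))] :
    ∑ q' ∈ Finset.univ.filter (fun q' : DoubleCoset.Quotient (Γ : Set G) (K' : Set G) =>
        DoubleCoset.mk Γ K q'.out = DoubleCoset.mk Γ K x),
      (Γ ⊓ K'.map (MulAut.conj q'.out).toMonoidHom).relIndex (Γ ⊓ K.map (MulAut.conj q'.out).toMonoidHom) =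
      K'.relIndex K := by
  classical
  -- (1) `Λ = Γ ∩ xKx⁻¹`, the conjugation `ψ : Λ → K`, `γ ↦ x⁻¹γx`, and the induced action on `S = K/K'`
  let Λ : Subgroup G := Γ ⊓ K.map (MulAut.conj x).toMonoidHom
  have hΛK : ∀ γ : Λ, x⁻¹ * (γ : G) * x ∈ K := fun γ => (mem_map_conj_iff K x γ).mp (Subgroup.mem_inf.mp γ.2).2
  let ψ : Λ →* K :=
    { toFun := fun γ => ⟨x⁻¹ * (γ : G) * x, hΛK γ⟩
      map_one' := by ext; simp
      map_mul' := fun a b => by ext; simp [mul_assoc] }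
  let S := K ⧸ K'.subgroupOf K
  letI : MulAction Λ S := MulAction.compHom S ψ
  letI : Fintype S := Subgroup.fintypeQuotientOfFiniteIndex
  -- (2) §1 for this action, and `#S = [K : K']`
  have hcount : ∑ ω : orbitRel.Quotient Λ S, (stabilizer Λ ω.out).index = Fintype.card S :=
    sum_index_stabilizer_eq_card Λ
  have hcard : Fintype.card S = K'.relIndex K := by
    rw [← Nat.card_eq_fintype_card]
    rfl
  -- (3) stabilisers: `Stab_Λ(kK') = Γ ∩ (xk)K'(xk)⁻¹`, of index `[Γ ∩ (xk)K(xk)⁻¹ : Γ ∩ (xk)K'(xk)⁻¹]`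
  have hstab : ∀ k : K, stabilizer Λ (QuotientGroup.mk k : S) =
      (Γ ⊓ K'.map (MulAut.conj (x * k)).toMonoidHom).subgroupOf Λ := by
    intro k
    ext γ
    simp only [mem_stabilizer_iff, Subgroup.mem_subgroupOf, Subgroup.mem_inf, mem_map_conj_iff]
    change (ψ γ • (QuotientGroup.mk k : S)) = QuotientGroup.mk k ↔ (γ : G) ∈ Γ ∧ (x * k)⁻¹ * γ * (x * k) ∈ K'
    rw [MulAction.Quotient.smul_mk, smul_eq_mul, QuotientGroup.eq, Subgroup.mem_subgroupOf]
    have e : (((ψ γ * k)⁻¹ * k : K) : G) = ((x * k)⁻¹ * γ * (x * k))⁻¹ := by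
      simp [ψ, mul_assoc, mul_inv_rev]
    rw [e, inv_mem_iff]
    exact ⟨fun h => ⟨(Subgroup.mem_inf.mp γ.2).1, h⟩, fun h => h.2⟩
  have hidx : ∀ k : K, (stabilizer Λ (QuotientGroup.mk k : S)).index =
      (Γ ⊓ K'.map (MulAut.conj (x * k)).toMonoidHom).relIndex (Γ ⊓ K.map (MulAut.conj (x * k)).toMonoidHom) := by
    intro k
    rw [hstab k, map_conj_mul_of_mem K x k.2]
    rfl
  -- (4) the classes `Γ (xa) K'`, `Γ (xb) K'` agree iff `aK'`, `bK'` are in one `Λ`-orbit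
  have hrel : ∀ a b : K, DoubleCoset.mk Γ K' (x * a) = DoubleCoset.mk Γ K' (x * b) ↔
      ∃ γ : Λ, γ • (QuotientGroup.mk b : S) = QuotientGroup.mk a := by
    intro a b
    constructor
    · intro h
      obtain ⟨u, hu, k', hk', hb⟩ := (DoubleCoset.eq Γ K' (x * a) (x * b)).mp h
      have hux : x⁻¹ * u * x = (b : G) * k'⁻¹ * (a : G)⁻¹ := by
        calc x⁻¹ * u * x = x⁻¹ * (u * (x * (a : G)) * k') * k'⁻¹ * (a : G)⁻¹ := by simp [mul_assoc]
          _ = x⁻¹ * (x * (b : G)) * k'⁻¹ * (a : G)⁻¹ := by rw [← hb]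
          _ = (b : G) * k'⁻¹ * (a : G)⁻¹ := by simp [mul_assoc]
      have huK : u ∈ K.map (MulAut.conj x).toMonoidHom := by
        rw [mem_map_conj_iff, hux]
        exact K.mul_mem (K.mul_mem b.2 (K.inv_mem (hK' hk'))) (K.inv_mem a.2)
      let γ₀ : Λ := ⟨u, Subgroup.mem_inf.mpr ⟨hu, huK⟩⟩
      refine ⟨γ₀⁻¹, ?_⟩
      change (ψ γ₀⁻¹ • (QuotientGroup.mk b : S)) = QuotientGroup.mk a
      rw [MulAction.Quotient.smul_mk, smul_eq_mul, QuotientGroup.eq, Subgroup.mem_subgroupOf]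
      have e : (((ψ γ₀⁻¹ * b)⁻¹ * a : K) : G) = (b : G)⁻¹ * (x⁻¹ * u * x) * a := by
        simp [ψ, γ₀, mul_assoc, mul_inv_rev]
      rw [e, hux]
      simpa [mul_assoc] using K'.inv_mem hk'
    · rintro ⟨γ, hγ⟩
      change (ψ γ • (QuotientGroup.mk b : S)) = QuotientGroup.mk a at hγ
      rw [MulAction.Quotient.smul_mk, smul_eq_mul, QuotientGroup.eq, Subgroup.mem_subgroupOf] at hγ
      rw [DoubleCoset.eq]
      refine ⟨(γ : G)⁻¹, Γ.inv_mem (Subgroup.mem_inf.mp γ.2).1, ((((ψ γ * b)⁻¹ * a : K) : G))⁻¹, K'.inv_mem hγ, ?_⟩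
      simp [ψ, mul_assoc, mul_inv_rev]
  -- (5) the fibre map `S → Γ\G/K'`, `kK' ↦ Γ (xk) K'`, and its descent to the orbit space
  have hwd : ∀ a b : K, (QuotientGroup.mk a : S) = QuotientGroup.mk b →
      DoubleCoset.mk Γ K' (x * a) = DoubleCoset.mk Γ K' (x * b) := by
    intro a b h
    rw [QuotientGroup.eq, Subgroup.mem_subgroupOf] at h
    rw [DoubleCoset.eq]
    exact ⟨1, Γ.one_mem, ((a⁻¹ * b : K) : G), h, by simp [mul_assoc]⟩
  let F₁ : S → DoubleCoset.Quotient (Γ : Set G) (K' : Set G) := fun s =>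
    Quotient.liftOn' s (fun k : K => DoubleCoset.mk Γ K' (x * k)) (fun a b h => hwd a b (Quotient.sound' h))
  have hF₁ : ∀ k : K, F₁ (QuotientGroup.mk k) = DoubleCoset.mk Γ K' (x * k) := fun k => rfl
  have hP₁ : ∀ s : S, DoubleCoset.mk Γ K (F₁ s).out = DoubleCoset.mk Γ K x := by
    intro s
    induction s using QuotientGroup.induction_on with
    | H k =>
      rw [hF₁, mk_out_mk_eq_of_le Γ K K' hK', DoubleCoset.eq]
      exact ⟨1, Γ.one_mem, (k : G)⁻¹, K.inv_mem k.2, by simp⟩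
  have hF₁orb : ∀ s₁ s₂ : S, (∃ γ : Λ, γ • s₂ = s₁) → F₁ s₁ = F₁ s₂ := by
    intro s₁ s₂
    induction s₁ using QuotientGroup.induction_on with
    | H a =>
      induction s₂ using QuotientGroup.induction_on with
      | H b =>
        intro h
        rw [hF₁, hF₁]
        exact (hrel a b).mpr h
  let F : orbitRel.Quotient Λ S →
      {q' : DoubleCoset.Quotient (Γ : Set G) (K' : Set G) // DoubleCoset.mk Γ K q'.out = DoubleCoset.mk Γ K x} := fun ω =>
    Quotient.liftOn' ω (fun s => ⟨F₁ s, hP₁ s⟩)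
      (fun s₁ s₂ h => Subtype.ext (hF₁orb s₁ s₂ (MulAction.mem_orbit_iff.mp (MulAction.orbitRel_apply.mp h))))
  have hF : ∀ s : S, (F (Quotient.mk'' s)).1 = F₁ s := fun s => rfl
  -- (6) `F` is a bijection onto the fibre
  have hFinj : Function.Injective F := by
    intro ω₁ ω₂ h
    induction ω₁ using Quotient.inductionOn' with
    | h s₁ =>
      induction ω₂ using Quotient.inductionOn' with
      | h s₂ =>
        have h' : F₁ s₁ = F₁ s₂ := by rw [← hF, ← hF, h]
        apply Quotient.sound'
        change s₁ ∈ MulAction.orbit Λ s₂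
        induction s₁ using QuotientGroup.induction_on with
        | H a =>
          induction s₂ using QuotientGroup.induction_on with
          | H b =>
            rw [hF₁, hF₁] at h'
            exact MulAction.mem_orbit_iff.mpr ((hrel a b).mp h')
  have hFsurj : Function.Surjective F := by
    rintro ⟨q', hq'⟩
    obtain ⟨u, hu, k, hk, he⟩ := (DoubleCoset.eq Γ K x q'.out).mp hq'.symm
    refine ⟨Quotient.mk'' (QuotientGroup.mk ⟨k, hk⟩ : S), Subtype.ext ?_⟩
    rw [hF, hF₁]
    change DoubleCoset.mk Γ K' (x * k) = q'
    rw [← DoubleCoset.out_eq' Γ K' q', he, DoubleCoset.eq]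
    exact ⟨u, hu, 1, K'.one_mem, by simp [mul_assoc]⟩
  -- (7) transport the §1 sum along `F`
  have hsum : ∑ ω : orbitRel.Quotient Λ S, (stabilizer Λ ω.out).index =
      ∑ q : {q' : DoubleCoset.Quotient (Γ : Set G) (K' : Set G) // DoubleCoset.mk Γ K q'.out = DoubleCoset.mk Γ K x},
        (Γ ⊓ K'.map (MulAut.conj q.1.out).toMonoidHom).relIndex (Γ ⊓ K.map (MulAut.conj q.1.out).toMonoidHom) := by
    refine Fintype.sum_equiv (Equiv.ofBijective F ⟨hFinj, hFsurj⟩) _ _ (fun ω => ?_)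
    obtain ⟨k, hk⟩ : ∃ k : K, (QuotientGroup.mk k : S) = ω.out := QuotientGroup.mk_surjective ω.out
    have hω : F ω = F (Quotient.mk'' ω.out) := by rw [Quotient.out_eq']
    rw [Equiv.ofBijective_apply, hω, hF, ← hk, hF₁, hidx k]
    exact relIndex_inf_map_conj_eq_of_rel Γ K K' hK' (DoubleCoset.out_eq' Γ K' _)
  rw [Finset.sum_subtype (p := fun q' : DoubleCoset.Quotient (Γ : Set G) (K' : Set G) =>
      DoubleCoset.mk Γ K q'.out = DoubleCoset.mk Γ K x) _ (fun q' => by simp), ← hsum, hcount, hcard]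

end Literature.GroupTheory
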